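import Literature.NumberTheory.LFunctions.Zhang2022.Section4Statements
import Literature.NumberTheory.LFunctions.Zhang2022.Section4Lemma43Holds
import HarnessLib

/-!
# Zhang (2022) §4: the deduction claim `Ded43b` (second step of the proof of Lemma 4.3), DISCHARGED

Topic `Literature/NumberTheory/LFunctions/Zhang2022` (Landau–Siegel audit tree; verdict-neutral).
Y. Zhang, *Discrete mean estimates and the Landau–Siegel zero*, arXiv:2211.02515v1 (2022)
[Zhang2022LandauSiegel], §4, proof of Lemma 4.3, p. 17 — **an unrefereed manuscript under
adjudication**; nothing here asserts or denies its Theorems 1–2.  Theorems only (no definitions, no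
named facts).

`Section4Statements.lean` (namespace `Section4`) records the second step of the printed proof of
Lemma 4.3 ("the result follows by Lemma 4 of [15, Chapter 2]" — Borel–Carathéodory for the
derivative) as the NAMED IMPLICATION `Ded43b : FTwoSided88 → Lemma43`.  Its conclusion
`Skeleton.Lemma43` ("`(F′/F)(s,ψ) = O(𝓛)` on `Ω₂`") is meanwhile a tree theorem —
`Skeleton.lemma43_holds` (`Section4Lemma43Holds.lean`: the landed edges composed with
`lemma41_holds`, `lemma42_holds`) — so the edge-claim holds outright.

* `ded43b_holds` — the discharge (net debt −1).

## References

* Y. Zhang, arXiv:2211.02515v1 (2022), §4 Lemma 4.3 and its proof, p. 17.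
  [cite: Zhang2022LandauSiegel, §4 Lemma 4.3 (proof) p. 17]
-/

noncomputable section

namespace Literature.NumberTheory.LFunctions.Zhang2022.Section4

open Skeleton

/-- **Proof of Lemma 4.3, second step** (`Z22:Lem4.3.pf`), DISCHARGED: the named implication
`FTwoSided88 → Lemma43` holds, its conclusion being the tree theorem `Skeleton.lemma43_holds`.
[cite: Zhang2022LandauSiegel, §4 Lemma 4.3 (proof) p. 17] -/
theorem ded43b_holds : Ded43b := fun _ => lemma43_holds

end Literature.NumberTheory.LFunctions.Zhang2022.Section4

end
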